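import Literature.Analysis.FluidPDE.WeakSolution
import Literature.Analysis.FluidPDE.Seregin2023.TypeIIEulerZoom
import Literature.Analysis.FluidPDE.SelfSimilarProofs
import HarnessLib

/-!
# No discretely self-similar Euler blow-up in the energy-conserving scale under the Type-I
# gradient condition (Chae–Wolf, CMP 376 (2020), Corollary 1.5)

Analysis/FluidPDE fact file: ONE named fact (a `def … : Prop`, D-0014) with its precise cite,
plus proved companions. No `sorry`.

D. Chae, J. Wolf, *Energy concentrations and Type I blow-up for the 3D Euler equations*,
Comm. Math. Phys. **376** (2020) 1627–1669 (arXiv:1706.02020), study a solution `v` of the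
incompressible Euler equations (1.1) `∂ₜv + (v·∇)v = −∇p`, `∇·v = 0` on `ℝⁿ × (−1, 0)` in the class

  `v ∈ L^∞(−1,0; L²_σ(ℝⁿ)) ∩ L^∞_loc([−1,0); W^{1,∞}(ℝⁿ))`

under the **Type I condition for the velocity gradient** (1.2)

  `sup_{t ∈ (−1,0)} (−t) ‖∇v(t)‖_{L^∞} < +∞`.

Their Theorem 1.1 / Corollary 1.2 exclude atomic concentration of the energy measure
`|v(t)|² dx` as `t → 0⁻`; since a **discretely self-similar** blow-up in the **energy-conserving
scale** concentrates all its energy at one point (their §5, Cor. 5.2), they deduce: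

> **Corollary 1.5.** Let `v ∈ L^∞(−1,0; L²_σ(ℝⁿ)) ∩ L^∞_loc([−1,0); W^{1,∞}(ℝⁿ))` be a solution of
> the Euler equations (1.1) satisfying (1.2). If `v` is a `λ`-DSS solution with the energy
> conserving scale, i.e. if there exists `λ > 1` such that
> `v(x,t) = λ^{n/2} v(λx, λ^{(n+2)/2} t)` for all `(x,t) ∈ ℝⁿ × (−1,0)` ((1.7)), then `v ≡ 0`.

(General self-similar scaling (1.6): `v(x,t) = λ^α v(λx, λ^{α+1}t)`; "discretely self-similar
solutions preserve the energy only if `α = n/2`, which is called the energy conserving scale" —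
p. 4. This is the scale left open by Chae 2007 / Chae–Shvydkoy 2013, whose `L^p`-profile
exclusions need `p ≠ 2`.)

## What is here

* `chaeWolf2020_dss_energyConservingScale` — **Corollary 1.5 for `n = 3`** (`α = 3/2`,
  time exponent `α + 1 = 5/2`) as a named fact, stated for the tree's pressure-explicit
  distributional Euler solutions on the slab `(−1,0) × ℝ³` (`IsDistributionalEulerSolutionOn`),
  with the function-space hypotheses written pointwise in time (square-integrable weakly
  divergence-free slices of bounded energy; bounded and Lipschitz slices, uniformly on every
  `(−1, T]`, `T < 0`; Lipschitz modulus `≤ M/(−t)`), and the conclusion `v = 0` a.e. on the slab.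
* `chaeWolf2020_dss_energyConservingScale.of_selfSimilar` — PROVED from the fact: the exactly
  self-similar case (the scaling identity for every `λ > 0`) is the case `λ = 2`.
* `dss_energyConservingScale_iff_eulerZoom` — PROVED dictionary: hypothesis (1.7) is the
  fixed-point identity `v^{λ,3/2} = v` for Seregin's Euler scaling `Seregin2023.eulerZoom (3/2) λ`
  (`v^{λ,α}(y,τ) = λ^α v(λ^{α+1}τ, λy)`, [Seregin2023] §2), on the slab; with
  `Seregin2023.rateOfAlpha (3/2) = 2/5` (`rateOfAlpha_three_halves`) this is the endpoint
  `α = 3/2 ⇔ ρ = α − 1 = 1/2 ⇔ γ = 1/(α+1) = 2/5` of the Chae–Shvydkoy window.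
* `chaeWolf2020_dss_energyConservingScale.ancient` — PROVED from the fact: the same statement for
  solutions on the whole past `(−∞,0) × ℝ³` (hypotheses on every window `(S,T]`, `T < 0`;
  conclusion `v = 0` a.e. on `(−∞,0) × ℝ³`), by the Euler case `ν = 0` of the Navier–Stokes
  rescaling `w(s,y) = μ v(μ²s, μy)` (`IsDistributionalNSSolutionOn.stRescale`), which commutes
  with the `λ`-DSS symmetry, preserves the Type-I constant and divides the energy by `μ`.

## Design notes (faithfulness)

* The printed class is `n`-dimensional and allows a general domain `Ω` in Theorem 1.1; we vendor
  the whole-space case `n = 3` that the tree's consumers (route `NavierStokesRegularity/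
  EulerZoomLiouville`, crux `PowerGaugeEulerLiouville` at `ρ = 1/2`, rungs C1/C2 "exactly /
  discretely self-similar members") import. `-- TODO(general form): n ≥ 2; Theorem 1.1 (no atoms
  of the energy measure in a domain Ω) and Corollary 1.2 are not typed.`
* Every hypothesis here implies the printed one: a pressure-explicit distributional solution
  with `p ∈ L¹_loc` is in particular a solution of (1.1) in the (pressure-free) sense used by
  Chae–Wolf (their Def. 2.1 reconstructs the pressure locally from `v`); pointwise-in-time bounds
  for every `t` imply the `L^∞`/`L^∞_loc` (essential) bounds; on `ℝⁿ`, `W^{1,∞} = ` bounded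
  Lipschitz functions with `‖∇v‖_∞` comparable to the Lipschitz modulus, so (1.2) is the
  hypothesis `‖v(t,x) − v(t,y)‖ ≤ (M/(−t))‖x − y‖`; `L²_σ` = square-integrable and weakly
  divergence-free. The DSS identity (1.7) is asked, as printed, for all `(x,t) ∈ ℝ³ × (−1,0)` —
  for `t ≤ −λ^{−5/2}` it refers to values of `v` at times `< −1`, which are part of the datum `v`
  (a `λ`-DSS solution is determined on the whole past; consumers with ancient solutions have the
  identity for all `t < 0`).
* The conclusion is `v = 0` almost everywhere on `(−1,0) × ℝ³` (the printed `v ≡ 0` in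
  `L^∞(−1,0; L²)`); a pointwise-everywhere conclusion would be false for the pointwise-in-time
  hypotheses used here (values on a null set of times are not seen by the equation).
* No NS object is involved: this is a statement about the EULER equations (`ν = 0`).

## Mathlib / tree search

`lean search 'ChaeWolf2020EulerTypeI|energy conserving scale|1706.02020'`: cited in two route
texts (`Theses/OddMorawetz`, `Theses/WeakLambdaEndpoint`), no Literature declaration. Reused tree
vocabulary: `IsDistributionalEulerSolutionOn`, `slab` (`WeakSolution`), `IsWeaklyDivFree`
(`VectorCalculus`), `Seregin2023.eulerZoom`, `Seregin2023.rateOfAlpha` (`Seregin2023/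
TypeIIEulerZoom`). Related but different tree facts: `chaeWolf2017_dss_typeI_decay`
(Navier–Stokes, parabolic scale), `chaeShvydkoy2013_Lp_exclusion` (profiles in `L^p`, `p ≥ 3`),
`chae2007_asymptoticallySelfSimilar_local`, `CIV2026_collapseExponent_ge_two_fifths`.

## References

* D. Chae, J. Wolf, *Energy concentrations and Type I blow-up for the 3D Euler equations*,
  Comm. Math. Phys. 376 (2020), no. 2, 1627–1669, doi:10.1007/s00220-019-03566-6,
  arXiv:1706.02020: Thm. 1.1, Cor. 1.2, (1.6)–(1.7), Cor. 1.5, §5 (Lemma 5.1, Cor. 5.2).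
  [ChaeWolf2020EulerTypeI]
* G. Seregin, *Remarks on Type II blowups of solutions to the Navier–Stokes equations*,
  arXiv:2304.04045 (2023), §2 (Euler scaling), §5 (5.2). [Seregin2023]
-/

noncomputable section

open MeasureTheory Set Function
open scoped ENNReal

namespace Literature.Analysis.FluidPDE

/-- **Chae–Wolf 2020, Corollary 1.5 (`n = 3`): no discretely self-similar Euler blow-up in the
energy-conserving scale under the Type-I gradient condition.** Let `v : ℝ × ℝ³ → ℝ³` (with some
pressure `p`) be a distributional solution of the incompressible Euler equations on
`(−1,0) × ℝ³` such that: `v ∈ L^∞(−1,0; L²_σ(ℝ³))` (every slice `v(t)`, `t ∈ (−1,0)`, is square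
integrable, weakly divergence free, with `∫|v(t)|² ≤ E`); `v ∈ L^∞_loc([−1,0); W^{1,∞}(ℝ³))` (on
every `(−1,T]`, `T < 0`, the slices are bounded and Lipschitz with one constant); the Type I
condition (1.2) `sup_{t∈(−1,0)} (−t)‖∇v(t)‖_∞ < ∞` (Lipschitz modulus of `v(t)` at most
`M/(−t)`); and `v` is `λ`-DSS in the energy-conserving scale `α = n/2 = 3/2` ((1.7)):
`v(x,t) = λ^{3/2} v(λx, λ^{5/2}t)` for all `(x,t) ∈ ℝ³ × (−1,0)`, for some `λ > 1`. Then `v ≡ 0`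
(here: `v = 0` a.e. on `(−1,0) × ℝ³`). Special case `n = 3`, `Ω = ℝ³` of the printed statement.
[cite: ChaeWolf2020EulerTypeI, Cor. 1.5] -/
def chaeWolf2020_dss_energyConservingScale : Prop :=
  ∀ (v : ℝ → EuclideanSpace ℝ (Fin 3) → EuclideanSpace ℝ (Fin 3))
    (p : ℝ → EuclideanSpace ℝ (Fin 3) → ℝ),
    IsDistributionalEulerSolutionOn
        (slab (EuclideanSpace ℝ (Fin 3)) (Ioo (-1) 0) isOpen_Ioo) 0 v p →
    -- `v ∈ L^∞(−1,0; L²_σ(ℝ³))`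
    (∃ E : ℝ, ∀ t ∈ Ioo (-1 : ℝ) 0,
        MemLp (v t) 2 volume ∧ IsWeaklyDivFree (v t) ∧ ∫ x, ‖v t x‖ ^ 2 ≤ E) →
    -- `v ∈ L^∞_loc([−1,0); W^{1,∞}(ℝ³))`
    (∀ T : ℝ, T < 0 → ∃ K : ℝ, ∀ t ∈ Ioc (-1 : ℝ) T, ∀ x y,
        ‖v t x‖ ≤ K ∧ ‖v t x - v t y‖ ≤ K * ‖x - y‖) →
    -- Type I condition (1.2): `sup_{t ∈ (−1,0)} (−t)‖∇v(t)‖_∞ < ∞`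
    (∃ M : ℝ, ∀ t ∈ Ioo (-1 : ℝ) 0, ∀ x y, ‖v t x - v t y‖ ≤ M / (-t) * ‖x - y‖) →
    -- `λ`-DSS in the energy-conserving scale (1.7), `n = 3`
    (∃ l : ℝ, 1 < l ∧ ∀ t ∈ Ioo (-1 : ℝ) 0, ∀ x,
        v t x = (l ^ (3 / 2 : ℝ)) • v (l ^ (5 / 2 : ℝ) * t) (l • x)) →
    uncurry v =ᵐ[volume.restrict (Ioo (-1 : ℝ) 0 ×ˢ (univ : Set (EuclideanSpace ℝ (Fin 3))))] 0

/-- **The exactly self-similar case of Corollary 1.5.** If the scaling identity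
`v(x,t) = λ^{3/2} v(λx, λ^{5/2}t)` holds on `ℝ³ × (−1,0)` for EVERY `λ > 0` (a self-similar
solution in the energy-conserving scale, (1.6) with `α = 3/2`), then `v` is in particular `2`-DSS,
so (given the fact) `v = 0` a.e. on the slab. [cite: ChaeWolf2020EulerTypeI, Cor. 1.5 with (1.6)] -/
theorem chaeWolf2020_dss_energyConservingScale.of_selfSimilar
    (h : chaeWolf2020_dss_energyConservingScale)
    (v : ℝ → EuclideanSpace ℝ (Fin 3) → EuclideanSpace ℝ (Fin 3))
    (p : ℝ → EuclideanSpace ℝ (Fin 3) → ℝ)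
    (hsol : IsDistributionalEulerSolutionOn
        (slab (EuclideanSpace ℝ (Fin 3)) (Ioo (-1) 0) isOpen_Ioo) 0 v p)
    (hE : ∃ E : ℝ, ∀ t ∈ Ioo (-1 : ℝ) 0,
        MemLp (v t) 2 volume ∧ IsWeaklyDivFree (v t) ∧ ∫ x, ‖v t x‖ ^ 2 ≤ E)
    (hW : ∀ T : ℝ, T < 0 → ∃ K : ℝ, ∀ t ∈ Ioc (-1 : ℝ) T, ∀ x y,
        ‖v t x‖ ≤ K ∧ ‖v t x - v t y‖ ≤ K * ‖x - y‖)
    (hI : ∃ M : ℝ, ∀ t ∈ Ioo (-1 : ℝ) 0, ∀ x y, ‖v t x - v t y‖ ≤ M / (-t) * ‖x - y‖)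
    (hss : ∀ l : ℝ, 0 < l → ∀ t ∈ Ioo (-1 : ℝ) 0, ∀ x,
        v t x = (l ^ (3 / 2 : ℝ)) • v (l ^ (5 / 2 : ℝ) * t) (l • x)) :
    uncurry v =ᵐ[volume.restrict (Ioo (-1 : ℝ) 0 ×ˢ (univ : Set (EuclideanSpace ℝ (Fin 3))))] 0 :=
  h v p hsol hE hW hI ⟨2, one_lt_two, hss 2 two_pos⟩

/-- **Dictionary with Seregin's Euler scaling.** The DSS hypothesis (1.7) of Corollary 1.5 says that
`v` is a fixed point, on the slab `(−1,0) × ℝ³`, of the Euler scaling `v ↦ v^{λ,α}`,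
`v^{λ,α}(y,τ) = λ^α v(λ^{α+1}τ, λy)` ([Seregin2023] §2, `Seregin2023.eulerZoom`) at the
energy-conserving exponent `α = 3/2` (`α + 1 = 5/2`). [cite: ChaeWolf2020EulerTypeI, (1.6)–(1.7)] -/
theorem dss_energyConservingScale_iff_eulerZoom
    (v : ℝ → EuclideanSpace ℝ (Fin 3) → EuclideanSpace ℝ (Fin 3)) (l : ℝ) :
    (∀ t ∈ Ioo (-1 : ℝ) 0, ∀ x, v t x = (l ^ (3 / 2 : ℝ)) • v (l ^ (5 / 2 : ℝ) * t) (l • x)) ↔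
      ∀ t ∈ Ioo (-1 : ℝ) 0, ∀ x, Seregin2023.eulerZoom (3 / 2) l v t x = v t x := by
  have h52 : (3 / 2 : ℝ) + 1 = 5 / 2 := by norm_num
  refine forall₂_congr fun t _ => forall_congr' fun x => ?_
  rw [Seregin2023.eulerZoom_apply, h52, eq_comm]

/-- The energy-conserving exponent `α = 3/2` is the endpoint `γ = 1/(α+1) = 2/5` of the collapse
rates (Seregin's `rateOfAlpha`; Chae–Shvydkoy's window is `α ∈ (1, 3/2]`, i.e.
`γ ∈ [2/5, 1/2)`). [cite: ChaeWolf2020EulerTypeI, (1.6) with α = n/2] -/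
theorem rateOfAlpha_three_halves : Seregin2023.rateOfAlpha (3 / 2) = 2 / 5 := by
  rw [Seregin2023.rateOfAlpha]
  norm_num


/-! ### The ancient form: solutions on `(−∞, 0) × ℝ³` -/

/-- `L^p` is invariant under `w ↦ c w(c ·)`, `c ≠ 0` (change of variables). [folklore] -/
private theorem memLp_nsRescaleData' {w : EuclideanSpace ℝ (Fin 3) → EuclideanSpace ℝ (Fin 3)}
    (hw : MemLp w 2 volume) {c : ℝ} (hc : c ≠ 0) : MemLp (nsRescaleData c w) 2 volume := by
  have h1 : MemLp w 2 (Measure.map (fun x : EuclideanSpace ℝ (Fin 3) => c • x) volume) := by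
    rw [Measure.map_addHaar_smul volume hc]
    exact hw.smul_measure ENNReal.ofReal_ne_top
  have h2 : MemLp (fun x => w (c • x)) 2 volume :=
    h1.comp_of_map (measurable_const_smul _).aemeasurable
  exact h2.const_smul c

/-- **Corollary 1.5 for ancient solutions.** For a `λ`-DSS solution the datum lives on the whole
past: if `(v,p)` is a distributional Euler solution on `(−∞,0) × ℝ³` with the hypotheses of
Corollary 1.5 on every bounded-below time window — slices in `L²_σ` with `∫|v(t)|² ≤ E` for all
`t < 0`, bounded Lipschitz slices uniformly on every `(S,T]`, `T < 0`, Type I modulus `M/(−t)`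
for all `t < 0`, and the DSS identity (1.7) for all `t < 0` — then `v = 0` a.e. on
`(−∞,0) × ℝ³`. PROOF (from the fact): for `μ ≥ 1` the Navier–Stokes/Euler rescaling
`w(s,y) = μ v(μ²s, μy)`, `q = μ² p(μ²s, μy)` (`IsDistributionalNSSolutionOn.stRescale` with
`ν = 0`) is again a solution with the same Type-I constant, energy `E/μ ≤ E`, commuting with the
`λ`-DSS symmetry; the fact on `(−1,0)` gives `w = 0` a.e. there, i.e. `v = 0` a.e. on
`(−μ²,0) × ℝ³` (`ae_restrict_of_ae_restrict_preimage_stAffine`), and `μ → ∞`. [cite: ChaeWolf2020EulerTypeI, Cor. 1.5] -/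
theorem chaeWolf2020_dss_energyConservingScale.ancient
    (h : chaeWolf2020_dss_energyConservingScale)
    (v : ℝ → EuclideanSpace ℝ (Fin 3) → EuclideanSpace ℝ (Fin 3))
    (p : ℝ → EuclideanSpace ℝ (Fin 3) → ℝ)
    (hsol : IsDistributionalEulerSolutionOn
        (slab (EuclideanSpace ℝ (Fin 3)) (Iio 0) isOpen_Iio) 0 v p)
    (hE : ∃ E : ℝ, ∀ t : ℝ, t < 0 →
        MemLp (v t) 2 volume ∧ IsWeaklyDivFree (v t) ∧ ∫ x, ‖v t x‖ ^ 2 ≤ E)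
    (hW : ∀ S T : ℝ, T < 0 → ∃ K : ℝ, ∀ t ∈ Ioc S T, ∀ x y,
        ‖v t x‖ ≤ K ∧ ‖v t x - v t y‖ ≤ K * ‖x - y‖)
    (hI : ∃ M : ℝ, ∀ t : ℝ, t < 0 → ∀ x y, ‖v t x - v t y‖ ≤ M / (-t) * ‖x - y‖)
    (hdss : ∃ l : ℝ, 1 < l ∧ ∀ t : ℝ, t < 0 → ∀ x,
        v t x = (l ^ (3 / 2 : ℝ)) • v (l ^ (5 / 2 : ℝ) * t) (l • x)) :
    uncurry v =ᵐ[volume.restrict (Iio (0 : ℝ) ×ˢ (univ : Set (EuclideanSpace ℝ (Fin 3))))] 0 := by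
  obtain ⟨E, hE⟩ := hE
  obtain ⟨M, hM⟩ := hI
  obtain ⟨l, hl, hdss⟩ := hdss
  -- Step 1: for every `μ ≥ 1`, `v = 0` a.e. on `(−μ², 0) × ℝ³`
  have step : ∀ μ : ℝ, 1 ≤ μ →
      ∀ᵐ z ∂(volume.restrict (Ioo (-μ ^ 2) (0 : ℝ) ×ˢ (univ : Set (EuclideanSpace ℝ (Fin 3))))),
        uncurry v z = 0 := by
    intro μ hμ
    have hμ0 : 0 < μ := lt_of_lt_of_le one_pos hμ
    have hμ2 : 0 < μ ^ 2 := by positivity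
    set w : ℝ → EuclideanSpace ℝ (Fin 3) → EuclideanSpace ℝ (Fin 3) :=
      μ • stPull (μ ^ 2) μ 0 0 v with hw_def
    set q : ℝ → EuclideanSpace ℝ (Fin 3) → ℝ := (μ ^ 2) • stPull (μ ^ 2) μ 0 0 p with hq_def
    have hw_apply : ∀ s y, w s y = μ • v (μ ^ 2 * s) (μ • y) := by
      intro s y
      rw [hw_def, smul_stPull_apply, zero_add, zero_add]
    have hw_slice : ∀ s, w s = nsRescaleData μ (v (μ ^ 2 * s)) := by
      intro s; funext y; rw [hw_apply]; rfl
    -- (a) `(w, q)` is a distributional Euler solution on `(−1,0) × ℝ³`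
    have hsolw : IsDistributionalEulerSolutionOn
        (slab (EuclideanSpace ℝ (Fin 3)) (Ioo (-1) 0) isOpen_Ioo) 0 w q := by
      have h1 := hsol.stRescale hμ0 hμ0 (by ring : μ ^ 2 = μ * μ) 0 0
      have hν : μ * 0 / μ = 0 := by simp
      have hf : ((μ ^ 2 * μ) • stPull (μ ^ 2) μ 0 0
          (0 : ℝ → EuclideanSpace ℝ (Fin 3) → EuclideanSpace ℝ (Fin 3))) = 0 := by
        funext s y
        rw [smul_stPull_apply]
        simp
      rw [hν, hf] at h1
      refine IsDistributionalNSSolutionOn.mono_holds h1 ?_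
      intro z hz
      rw [mem_stPreimage, mem_slab, stAffine_fst, zero_add]
      have hz' := (mem_slab.1 hz).2
      exact mul_neg_of_pos_of_neg hμ2 hz'
    -- (b) energy class
    have hEw : ∃ E' : ℝ, ∀ s ∈ Ioo (-1 : ℝ) 0,
        MemLp (w s) 2 volume ∧ IsWeaklyDivFree (w s) ∧ ∫ y, ‖w s y‖ ^ 2 ≤ E' := by
      refine ⟨E, fun s hs => ?_⟩
      have ht : μ ^ 2 * s < 0 := mul_neg_of_pos_of_neg hμ2 hs.2
      obtain ⟨hm, hdiv, hint⟩ := hE _ ht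
      refine ⟨?_, ?_, ?_⟩
      · rw [hw_slice]; exact memLp_nsRescaleData' hm hμ0.ne'
      · rw [hw_slice]; exact hdiv.nsRescaleData hμ0
      · have e1 : (fun y => ‖w s y‖ ^ 2) =
            fun y => (fun x => μ ^ 2 * ‖v (μ ^ 2 * s) x‖ ^ 2) (μ • y) := by
          funext y
          rw [hw_apply, norm_smul, mul_pow, Real.norm_eq_abs, sq_abs]
        rw [e1, Measure.integral_comp_smul volume (fun x => μ ^ 2 * ‖v (μ ^ 2 * s) x‖ ^ 2) μ,
          integral_const_mul, finrank_euclideanSpace_fin, smul_eq_mul]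
        have hI0 : 0 ≤ ∫ x, ‖v (μ ^ 2 * s) x‖ ^ 2 := integral_nonneg fun _ => by positivity
        have h3 : |(μ ^ 3)⁻¹| * (μ ^ 2 * ∫ x, ‖v (μ ^ 2 * s) x‖ ^ 2) =
            μ⁻¹ * ∫ x, ‖v (μ ^ 2 * s) x‖ ^ 2 := by
          rw [abs_of_pos (by positivity)]
          field_simp
        rw [h3]
        have h4 : μ⁻¹ ≤ 1 := inv_le_one_of_one_le₀ hμ
        nlinarith
    -- (c) bounded Lipschitz slices on `(−1, T]`
    have hWw : ∀ T : ℝ, T < 0 → ∃ K : ℝ, ∀ s ∈ Ioc (-1 : ℝ) T, ∀ x y,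
        ‖w s x‖ ≤ K ∧ ‖w s x - w s y‖ ≤ K * ‖x - y‖ := by
      intro T hT
      obtain ⟨K, hK⟩ := hW (-μ ^ 2) (μ ^ 2 * T) (mul_neg_of_pos_of_neg hμ2 hT)
      refine ⟨μ ^ 2 * |K|, fun s hs x y => ?_⟩
      have ht : μ ^ 2 * s ∈ Ioc (-μ ^ 2) (μ ^ 2 * T) := by
        constructor
        · have := hs.1; nlinarith
        · exact mul_le_mul_of_nonneg_left hs.2 hμ2.le
      have hKabs : K ≤ |K| := le_abs_self K
      obtain ⟨hb, hlip⟩ := hK _ ht (μ • x) (μ • y)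
      constructor
      · rw [hw_apply, norm_smul, Real.norm_eq_abs, abs_of_pos hμ0]
        have h1 : ‖v (μ ^ 2 * s) (μ • x)‖ ≤ |K| := hb.trans hKabs
        have hμμ : μ ≤ μ ^ 2 := by nlinarith
        calc μ * ‖v (μ ^ 2 * s) (μ • x)‖ ≤ μ * |K| := mul_le_mul_of_nonneg_left h1 hμ0.le
          _ ≤ μ ^ 2 * |K| := mul_le_mul_of_nonneg_right hμμ (abs_nonneg K)
      · rw [hw_apply, hw_apply, ← smul_sub, norm_smul, Real.norm_eq_abs, abs_of_pos hμ0]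
        rw [← smul_sub, norm_smul, Real.norm_eq_abs, abs_of_pos hμ0] at hlip
        have h' : ‖v (μ ^ 2 * s) (μ • x) - v (μ ^ 2 * s) (μ • y)‖ ≤ |K| * (μ * ‖x - y‖) :=
          hlip.trans (mul_le_mul_of_nonneg_right hKabs (by positivity))
        calc μ * ‖v (μ ^ 2 * s) (μ • x) - v (μ ^ 2 * s) (μ • y)‖
            ≤ μ * (|K| * (μ * ‖x - y‖)) := mul_le_mul_of_nonneg_left h' hμ0.le
          _ = μ ^ 2 * |K| * ‖x - y‖ := by ring
    -- (d) Type I modulus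
    have hIw : ∃ M' : ℝ, ∀ s ∈ Ioo (-1 : ℝ) 0, ∀ x y,
        ‖w s x - w s y‖ ≤ M' / (-s) * ‖x - y‖ := by
      refine ⟨M, fun s hs x y => ?_⟩
      have hs0 : 0 < -s := by linarith [hs.2]
      have ht : μ ^ 2 * s < 0 := mul_neg_of_pos_of_neg hμ2 hs.2
      have hlip := hM _ ht (μ • x) (μ • y)
      rw [← smul_sub, norm_smul, Real.norm_eq_abs, abs_of_pos hμ0] at hlip
      rw [hw_apply, hw_apply, ← smul_sub, norm_smul, Real.norm_eq_abs, abs_of_pos hμ0]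
      have e : M / -(μ ^ 2 * s) * (μ * ‖x - y‖) = μ⁻¹ * (M / -s * ‖x - y‖) := by
        field_simp
      rw [e] at hlip
      calc μ * ‖v (μ ^ 2 * s) (μ • x) - v (μ ^ 2 * s) (μ • y)‖
          ≤ μ * (μ⁻¹ * (M / -s * ‖x - y‖)) := mul_le_mul_of_nonneg_left hlip hμ0.le
        _ = M / -s * ‖x - y‖ := by field_simp
    -- (e) the DSS symmetry commutes with the rescaling
    have hdssw : ∃ l' : ℝ, 1 < l' ∧ ∀ s ∈ Ioo (-1 : ℝ) 0, ∀ x,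
        w s x = (l' ^ (3 / 2 : ℝ)) • w (l' ^ (5 / 2 : ℝ) * s) (l' • x) := by
      refine ⟨l, hl, fun s hs x => ?_⟩
      have ht : μ ^ 2 * s < 0 := mul_neg_of_pos_of_neg hμ2 hs.2
      rw [hw_apply, hw_apply, hdss _ ht (μ • x), smul_comm μ (l ^ (3 / 2 : ℝ)),
        smul_comm μ l x, mul_left_comm]
    -- (f) the fact, and transport back along `Φ(s,y) = (μ² s, μ y)`
    have hw0 := h w q hsolw hEw hWw hIw hdssw
    have hpre : stAffine (μ ^ 2) μ 0 (0 : EuclideanSpace ℝ (Fin 3)) ⁻¹'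
        (Ioo (-μ ^ 2) (0 : ℝ) ×ˢ (univ : Set (EuclideanSpace ℝ (Fin 3)))) =
        Ioo (-1 : ℝ) 0 ×ˢ (univ : Set (EuclideanSpace ℝ (Fin 3))) := by
      ext z
      simp only [mem_preimage, mem_prod, mem_univ, and_true, stAffine_fst, zero_add, mem_Ioo]
      constructor
      · rintro ⟨h1, h2⟩
        constructor <;> nlinarith
      · rintro ⟨h1, h2⟩
        constructor <;> nlinarith
    refine ae_restrict_of_ae_restrict_preimage_stAffine hμ2 hμ0 0 (0 : EuclideanSpace ℝ (Fin 3))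
      (P := fun z => uncurry v z = 0) ?_
    rw [hpre]
    filter_upwards [hw0] with z hz
    have hz' : μ • v (μ ^ 2 * z.1) (μ • z.2) = 0 := by
      rw [← hw_apply]; exact hz
    rw [smul_eq_zero] at hz'
    rcases hz' with hz' | hz'
    · exact absurd hz' hμ0.ne'
    · show v (stAffine (μ ^ 2) μ 0 0 z).1 (stAffine (μ ^ 2) μ 0 0 z).2 = 0
      rw [stAffine_fst, stAffine_snd, zero_add, zero_add]
      exact hz'
  -- Step 2: exhaust `(−∞, 0)` by the windows `(−(n+1)², 0)`
  have hcover : (Iio (0 : ℝ) ×ˢ (univ : Set (EuclideanSpace ℝ (Fin 3)))) =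
      ⋃ n : ℕ, (Ioo (-((n : ℝ) + 1) ^ 2) (0 : ℝ) ×ˢ (univ : Set (EuclideanSpace ℝ (Fin 3)))) := by
    ext z
    simp only [mem_prod, mem_Iio, mem_univ, and_true, mem_iUnion, mem_Ioo]
    constructor
    · intro hz
      obtain ⟨n, hn⟩ := exists_nat_gt (-z.1)
      refine ⟨n, ?_, hz⟩
      nlinarith
    · rintro ⟨n, hn, hz⟩
      exact hz
  rw [Filter.EventuallyEq, hcover, ae_restrict_iUnion_iff]
  intro n
  have := step ((n : ℝ) + 1) (by linarith [n.cast_nonneg (α := ℝ)])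
  filter_upwards [this] with z hz
  simpa using hz

end Literature.Analysis.FluidPDE

end
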